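import Summits.Ventures.QEC.Thresholds.ToricCodeDepolarizingKernelSymm
import Literature.Probability.RandomPlanarGeometry.SAWFiniteMemoryKernelSymmK16
import HarnessLib

/-!
# Toric-code thresholds from the KERNEL-checked SYMMETRY-REDUCED memory-16 Pönitz–Tittmann bound `μ(ℤ²) ≤ 2.6939`:
# `p_c > .0357` (perfect measurement, `Z` and `X` sectors), `y_c > .3712` (loss), `p_c^depol > .0535` — unconditional, tier CERTIFIED (kernel)

Venture QEC, `Summits/Ventures/QEC/Thresholds/` (continues `ToricCodeThresholdKernelSymm.lean` / `ToricCodeDepolarizingKernelSymm.lean`;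
LADDER item 03.PTMEM, rung 2). Input, axioms `propext`/`Classical.choice`/`Quot.sound`: `SAW.Zd.connectiveConstant_two_le_26939`
(`SAWFiniteMemoryKernelSymmK16.lean`: the symmetry-reduced trie certificate of the memory-16 automaton of `ℤ²`, `58 411` orbit
representatives of its `467 249` states, checked by `decide +kernel`; Pönitz–Tittmann 2000, Table 2, `d = 2, k = 16`: `2.6939`) — the same
automaton whose UNREDUCED certificate the tree evaluates by `native_decide` in `SAWFiniteMemory16.lean` (`μ ≤ 2.695`, CHECKED-native).
Through the unconditional parametric theorems `toricThreshold_connectiveConstant_le`, `lossThreshold_inv_connectiveConstant`,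
`toric_x_isThresholdLowerBound_of_z` (lattice duality) and `depolarizing_isThresholdLowerBound` (the `3/2` rule):

| theorem | statement | tier |
|---|---|---|
| `toricThreshold_kernelSymmK16`, `thresholdValue_26939_bounds`, `toricThreshold_0357`, `accuracyThreshold_gt_0357`, `hasThreshold_toric_0357`, `ToricCode.accuracyThreshold_minWeight_gt_0357`, `toric_decaysExponentially_0357` | perfect measurement, every min-weight decoder family: **`p_c > .0357`** (`.0357 < p₀(2.6939) < .0358`; kernel decimals so far `.0293 → .0322 → .0343 → .0348 → .0352 → .0355`) | CERTIFIED (kernel), unconditional |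
| `lossThreshold_kernelSymmK16`, `loss_accuracyThreshold_gt_0371` | loss channel: **`y_c > .3712`** (was `.3701`) | CERTIFIED (kernel), unconditional |
| `toric_x_isThresholdLowerBound_kernelSymmK16`, `toric_x_accuracyThreshold_gt_0357` | `X` sector (bit flips), every min-weight decoder family: **`p_c^X > .0357`** | CERTIFIED (kernel), unconditional |
| `toric_depolarizing_isThresholdLowerBound_kernelSymmK16`, `toric_depolarizing_accuracyThreshold_gt_0535`, canonical instances | depolarizing, sector-wise min-weight decoding: **`p_c^depol > .0535`** (was `.0532`) | CERTIFIED (kernel), unconditional |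

The KERNEL perfect-measurement decimal `.0357` is now within `.0001` of the CHECKED-native `.0358` (`μ ≤ 2.688`, k = 18) and `.0004` of
the CONDITIONAL `.0361` (Pönitz–Tittmann's printed `μ ≤ 2.679193`). NOT A THEOREM ANYWHERE: DKLP's printed `.0373` (CLAIM). Theorem-only file.

## References

* [DennisEtAl2002] E. Dennis, A. Kitaev, A. Landahl, J. Preskill, J. Math. Phys. 43 (2002) 4452,
  arXiv:quant-ph/0110143, §4.1, §5.3 eqs. (saw_2), (threshold_2d)–(p_c_2d), (fail_2d).
* [PonitzTittmann2000] A. Pönitz, P. Tittmann, Electron. J. Combin. 7 (2000) R21, §3 and Table 2 (`d = 2, k = 16`: `2.6939`).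
* [DumerKovalevPryadko2015] I. Dumer, A. A. Kovalev, L. P. Pryadko, PRL 115 (2015) 050502, p. 5.
-/

noncomputable section

namespace Summit.Ventures.QEC.Thresholds

open Filter Topology Finset Matrix
open Literature.InformationTheory.QuantumCodes
open Literature.InformationTheory.QuantumCodes.ToricCode
open Literature.Probability.RandomPlanarGeometry

/-! ### Perfect syndrome measurement: `p_c > .0357` -/

/-- **Toric-code threshold `≥ p₀(2.6939)`, UNCONDITIONAL, tier CERTIFIED (kernel)**, for every minimum-weight decoder
family (perfect measurement), from the kernel-checked symmetry-reduced memory-14 bound `μ(ℤ²) ≤ 2.6939`.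
[cite: DennisEtAl2002, §5.3 eqs. (saw_2), (threshold_2d)] -/
theorem toricThreshold_kernelSymmK16 {D : (L : ℕ) → ZDecoder (L + 1)}
    (hD : ∀ L, (D L).IsMinWeight (syn (L + 1)) (cycles (L + 1)) hammingNorm) :
    IsThresholdLowerBound (toricFailureFamily D) (thresholdValue 2.6939) :=
  toricThreshold_connectiveConstant_le (by norm_num) SAW.Zd.connectiveConstant_two_le_26939 hD

/-- Decimal certificate: `.0357 < p₀(2.6939) < .0358`. [cite: DennisEtAl2002, §5.3 eq. (p_c_2d)] -/
theorem thresholdValue_26939_bounds :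
    (0.0357 : ℝ) < thresholdValue 2.6939 ∧ thresholdValue 2.6939 < 0.0358 := by
  unfold thresholdValue
  constructor
  · have : Real.sqrt (1 - 1 / (2.6939 : ℝ) ^ 2) < 0.9286 := by
      rw [Real.sqrt_lt' (by norm_num)]
      norm_num
    linarith
  · have : (0.9284 : ℝ) < Real.sqrt (1 - 1 / (2.6939 : ℝ) ^ 2) := by
      rw [Real.lt_sqrt (by norm_num)]
      norm_num
    linarith

/-- Decimal form: every `0 ≤ p < .0357` is below threshold (perfect measurement, every min-weight decoder family) —
UNCONDITIONAL, tier CERTIFIED (kernel). [cite: DennisEtAl2002, §4.3 and §5.3 eq. (threshold_2d)] -/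
theorem toricThreshold_0357 {D : (L : ℕ) → ZDecoder (L + 1)}
    (hD : ∀ L, (D L).IsMinWeight (syn (L + 1)) (cycles (L + 1)) hammingNorm) :
    IsThresholdLowerBound (toricFailureFamily D) 0.0357 :=
  (toricThreshold_kernelSymmK16 hD).anti thresholdValue_26939_bounds.1.le

/-- **`p_c > .0357`** for every minimum-weight decoder family of the toric codes (perfect measurement) — UNCONDITIONAL,
tier CERTIFIED (kernel). [cite: DennisEtAl2002, §5.3 eq. (p_c_2d)] -/
theorem accuracyThreshold_gt_0357 {D : (L : ℕ) → ZDecoder (L + 1)}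
    (hD : ∀ L, (D L).IsMinWeight (syn (L + 1)) (cycles (L + 1)) hammingNorm) :
    (0.0357 : ℝ) < accuracyThreshold (toricFailureFamily D) :=
  lt_of_lt_of_le thresholdValue_26939_bounds.1
    (le_accuracyThreshold (toricThreshold_kernelSymmK16 hD) ((thresholdValue_le_half _).trans (by norm_num)))

/-- The canonical minimum-weight decoders: `p_c > .0357` — UNCONDITIONAL, kernel. [cite: DennisEtAl2002, §5.3 eq. (p_c_2d)] -/
theorem ToricCode.accuracyThreshold_minWeight_gt_0357 :
    (0.0357 : ℝ) < accuracyThreshold (toricFailureFamily fun L => Decoder.minWeight (syn (L + 1)) hammingNorm) :=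
  accuracyThreshold_gt_0357 fun L => ToricCode.isMinWeight_minWeight (L + 1)

/-- `HasThreshold` (PARTITION row-09 vocabulary) at the decimal `.0357` for every minimum-weight decoder family —
UNCONDITIONAL, kernel. [cite: DennisEtAl2002, §4.3 and §5.3 eq. (p_c_2d)] -/
theorem hasThreshold_toric_0357 {D : (L : ℕ) → ZDecoder (L + 1)}
    (hD : ∀ L, (D L).IsMinWeight (syn (L + 1)) (cycles (L + 1)) hammingNorm) :
    HasThreshold (fun L p => (D L).logicalFailureProb (syn (L + 1)) (boundaries (L + 1))
      (iidLaw (bitLaw (min p.toNNReal 1) (min_le_right _ _)))) 0.0357 :=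
  hasThreshold_of_isThresholdLowerBound (toricThreshold_0357 hD) (by norm_num)

/-- **Exponential decay at every `0 ≤ p ≤ .0357`**, UNCONDITIONAL, kernel, for every minimum-weight decoder family (walk-count
constant at `ν = 2.694 > μ(ℤ²)`; `.0357 < p₀(2.694)`). [cite: DennisEtAl2002, §5.3 eq. (fail_2d)] -/
theorem toric_decaysExponentially_0357 {D : (L : ℕ) → ZDecoder (L + 1)}
    (hD : ∀ L, (D L).IsMinWeight (syn (L + 1)) (cycles (L + 1)) hammingNorm) {p : ℝ}
    (hp₀ : 0 ≤ p) (hpp : p ≤ 0.0357) :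
    DecaysExponentially (toricFailureFamily D) p := by
  have hlt : SAW.Zd.connectiveConstant 2 < 2.694 :=
    lt_of_le_of_lt SAW.Zd.connectiveConstant_two_le_26939 (by norm_num)
  obtain ⟨C, hC⟩ := exists_sawCountBound_of_connectiveConstant_lt hlt
  have hval : (0.0357 : ℝ) < thresholdValue 2.694 := by
    unfold thresholdValue
    have : Real.sqrt (1 - 1 / (2.694 : ℝ) ^ 2) < 0.9286 := by
      rw [Real.sqrt_lt' (by norm_num)]
      norm_num
    linarith
  exact toric_decaysExponentially_sawCountBound (by norm_num) hC hD hp₀ (lt_of_le_of_lt hpp hval)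

/-! ### The loss channel: `y_c > .3712` -/

/-- **Loss threshold of the toric code `≥ 1/2.6939`** — UNCONDITIONAL, tier CERTIFIED (kernel).
[cite: DumerKovalevPryadko2015, p. 5 (toric erasure threshold)] -/
theorem lossThreshold_kernelSymmK16 : IsThresholdLowerBound erasureFamily (1 / 2.6939) := by
  refine lossThreshold_inv_connectiveConstant.anti ?_
  have h0 : 0 < SAW.Zd.connectiveConstant 2 := lt_of_lt_of_le one_pos (SAW.Zd.one_le_connectiveConstant 2)
  exact one_div_le_one_div_of_le h0 SAW.Zd.connectiveConstant_two_le_26939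

/-- **`y_c > .3712`** for the toric code under the loss channel — UNCONDITIONAL, tier CERTIFIED (kernel).
[cite: DumerKovalevPryadko2015, p. 5] -/
theorem loss_accuracyThreshold_gt_0371 : (0.3712 : ℝ) < accuracyThreshold erasureFamily :=
  lt_of_lt_of_le (by norm_num : (0.3712 : ℝ) < 1 / 2.6939)
    (le_accuracyThreshold lossThreshold_kernelSymmK16 (by norm_num))

/-! ### `X` sector and depolarizing noise -/

/-- **`X`-sector toric threshold `≥ p₀(2.6939)`** (kernel-checked symmetry-reduced memory-16 walk bound + lattice duality), every
minimum-weight decoder family of the plaquette syndrome. UNCONDITIONAL. [cite: DennisEtAl2002, §5.3 eqs. (saw_2), (threshold_2d)] -/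
theorem toric_x_isThresholdLowerBound_kernelSymmK16 (DX : (L : ℕ) → Decoder (Syndrome (L + 1)) (Chain (L + 1)))
    (hDX : ∀ L, (DX L).IsMinWeight (toricCode (L + 1)).xSyndrome
      ((toricCode (L + 1)).kerZ : Set (Chain (L + 1))) hammingNorm) :
    IsThresholdLowerBound (xFailureFamily (fun L => toricCode (L + 1)) DX) (thresholdValue 2.6939) :=
  toric_x_isThresholdLowerBound_of_z (fun _ hD => toricThreshold_kernelSymmK16 hD) DX hDX

/-- **`p_c^X > .0357`** (decimal, kernel) for bit flips on the toric code, every minimum-weight decoder family.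
[cite: DennisEtAl2002, §5.3 eq. (p_c_2d)] -/
theorem toric_x_accuracyThreshold_gt_0357 (DX : (L : ℕ) → Decoder (Syndrome (L + 1)) (Chain (L + 1)))
    (hDX : ∀ L, (DX L).IsMinWeight (toricCode (L + 1)).xSyndrome
      ((toricCode (L + 1)).kerZ : Set (Chain (L + 1))) hammingNorm) :
    (0.0357 : ℝ) < accuracyThreshold (xFailureFamily (fun L => toricCode (L + 1)) DX) :=
  lt_of_lt_of_le thresholdValue_26939_bounds.1
    (le_accuracyThreshold (toric_x_isThresholdLowerBound_kernelSymmK16 DX hDX)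
      ((thresholdValue_le_half _).trans (by norm_num)))

/-- **Depolarizing toric threshold `≥ (3/2)·p₀(2.6939) ≈ .0536`**, sector-wise minimum-weight decoding (any pair of
minimum-weight decoder families). UNCONDITIONAL, kernel. [cite: DennisEtAl2002, §4.1 (depolarizing channel vs. independent X/Z errors)] -/
theorem toric_depolarizing_isThresholdLowerBound_kernelSymmK16
    (DX : (L : ℕ) → Decoder (Syndrome (L + 1)) (Chain (L + 1))) (DZ : (L : ℕ) → ZDecoder (L + 1))
    (hDX : ∀ L, (DX L).IsMinWeight (toricCode (L + 1)).xSyndrome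
      ((toricCode (L + 1)).kerZ : Set (Chain (L + 1))) hammingNorm)
    (hDZ : ∀ L, (DZ L).IsMinWeight (syn (L + 1)) (cycles (L + 1)) hammingNorm) :
    IsThresholdLowerBound (depolarizingFailureFamily (fun L => toricCode (L + 1)) DX DZ)
      (3 / 2 * thresholdValue 2.6939) := by
  have hZ : IsThresholdLowerBound (zFailureFamily (fun L => toricCode (L + 1)) DZ) (thresholdValue 2.6939) := by
    rw [zFailureFamily_toricCode]
    exact toricThreshold_kernelSymmK16 hDZ
  have h := depolarizing_isThresholdLowerBound (fun L => toricCode (L + 1)) DX DZ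
    (toric_x_isThresholdLowerBound_kernelSymmK16 DX hDX) hZ ((min_le_left _ _).trans (thresholdValue_le_two_thirds _))
  rwa [min_self] at h

/-- **`p_c^depol > .0535`** (decimal, kernel) for the toric code under sector-wise minimum-weight decoding (was `.0522`).
[cite: DennisEtAl2002, §4.1 and §5.3] -/
theorem toric_depolarizing_accuracyThreshold_gt_0535
    (DX : (L : ℕ) → Decoder (Syndrome (L + 1)) (Chain (L + 1))) (DZ : (L : ℕ) → ZDecoder (L + 1))
    (hDX : ∀ L, (DX L).IsMinWeight (toricCode (L + 1)).xSyndrome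
      ((toricCode (L + 1)).kerZ : Set (Chain (L + 1))) hammingNorm)
    (hDZ : ∀ L, (DZ L).IsMinWeight (syn (L + 1)) (cycles (L + 1)) hammingNorm) :
    (0.0535 : ℝ) < accuracyThreshold (depolarizingFailureFamily (fun L => toricCode (L + 1)) DX DZ) := by
  have h := thresholdValue_26939_bounds.1
  refine lt_of_lt_of_le (by linarith)
    (le_accuracyThreshold (toric_depolarizing_isThresholdLowerBound_kernelSymmK16 DX DZ hDX hDZ) ?_)
  have := thresholdValue_le_half (2.6939 : ℝ)
  linarith

/-- Canonical instance: minimum-weight decoding of both syndromes — depolarizing threshold `≥ (3/2)·p₀(2.6939)`.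
UNCONDITIONAL, kernel. [cite: DennisEtAl2002, §4.1 and §5.1] -/
theorem toric_depolarizing_isThresholdLowerBound_kernelSymmK16_minWeight :
    IsThresholdLowerBound
      (depolarizingFailureFamily (fun L => toricCode (L + 1))
        (fun L => Decoder.minWeight (toricCode (L + 1)).xSyndrome hammingNorm)
        fun L => Decoder.minWeight (syn (L + 1)) hammingNorm)
      (3 / 2 * thresholdValue 2.6939) :=
  toric_depolarizing_isThresholdLowerBound_kernelSymmK16 _ _ toric_isMinWeight_minWeight_x
    fun L => ToricCode.isMinWeight_minWeight (L + 1)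

/-- Canonical decimal: `p_c^depol > .0535` for minimum-weight decoding of both syndromes — UNCONDITIONAL, kernel.
[cite: DennisEtAl2002, §4.1 and §5.3] -/
theorem ToricCode.depolarizing_accuracyThreshold_minWeight_gt_0535 :
    (0.0535 : ℝ) < accuracyThreshold
      (depolarizingFailureFamily (fun L => toricCode (L + 1))
        (fun L => Decoder.minWeight (toricCode (L + 1)).xSyndrome hammingNorm)
        fun L => Decoder.minWeight (syn (L + 1)) hammingNorm) :=
  toric_depolarizing_accuracyThreshold_gt_0535 _ _ toric_isMinWeight_minWeight_x
    fun L => ToricCode.isMinWeight_minWeight (L + 1)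

end Summit.Ventures.QEC.Thresholds
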